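import Summits.ValiantsHypothesis.ValiantsHypothesis.Theorems.KPlusLogSqLawTropicalBUpperBandTypes

/-!
# Route «KPlusLogSqLaw», crux `TropicalB` (stmt-ValiantsHypothesis-19771) — `TropicalB` ON THE BOUNDED UP-JUMP SECTOR:
# supports with `a ≤ b + u` obey `n ≤ 2^{(20u+8)(K + ⌊log₂ m⌋²)}`, all formats

HONEST FRAMING.  A SECTOR theorem toward the registered stubs `stub_tropThin` / `stub_tropFat` of `Cruxes/TropicalB/Lines/birth.lean`
(crux `TropicalB`, item stmt-ValiantsHypothesis-19771, route KPlusLogSqLaw, DRAFT; seat val-sym-trop-p5).  It generalises the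
Hessenberg sector theorem (`tropicalB_hessenberg`, up-jumps `≤ 1`, C = 30) to every fixed up-jump bound `u`: designs whose entry
`(a, b)` (row `a`, column `b`) is present only if `a ≤ b + u` — Leibniz terms = unit flows of «up-width» `≤ u` — obey the
conclusion of `TropicalB` with `C = 20u + 8`, for ALL `(m, K)`, in the window included.  The constant grows with `u`; for general
supports (`u = m`) the statement is empty, and `TropicalB` in the window stays OPEN.  Nothing here bears on `MatrixDescartes`
(stmt-ValiantsHypothesis-18050) or VP ≠ VNP.

THE ARGUMENT (Gusfield's divide and conquer with polynomially many cut states; no block structure needed) is proved as a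
STATE-COUNT META-THEOREM first — `card_optRestr_img_le_of_states` / `chain_le_of_states`: for ANY support class, if every present
term sends each column interval `[a, t)` onto one of `≤ T` row sets, then `n + 1 ≤ (mK+1)·(2T)^{⌊log₂ m⌋+1}` (so a counterexample
to the `K + log² m` law needs super-polynomially many cut states) — and then instantiated.  Let `V(J, R)` be the
set of restrictions to the column interval `J` of terms `p` with `σ(J) = R` that are restricted optima on `J` at some integer
slope (`IntervalOpt.optRestr d v ε J (fun p => J.image p.1 = R)`).  Split `J = [a, c)` at `t = a + 2^k`: every such term has
`σ([a, t)) = S` for some `S` in the shape family `shapes m u a t` of the sibling file (`image_mem_shapes`; `#shapes ≤ T :=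
((2u+1)(m+1)^{2u})²`), and then `σ([t, c)) = R \ S`; by SUB-ADDITIVITY (`IntervalOpt.card_optRestr_union_le`, both predicates fix
the images) `#V([a,c), R) ≤ Σ_S (#V([a,t), S) + #V([t,c), R \ S)) ≤ T · 2 · max`, so by induction on `k`
(`card_optRestr_img_le`) `#V(J, R) ≤ (mK+1)·(2T)^k` for `#J ≤ 2^k` (atoms: `IntervalOpt.card_optRestr_le_of_card_le_one`).  A dominant
chain with distinct consecutive terms injects into `V([0,m), [0,m))` (`IntervalOpt.chain_le_card_optRestr`), whence
`chain_le_upperBand : n + 1 ≤ (mK+1)·(2T)^{⌊log₂ m⌋+1}` and, after arithmetic (`upperBand_size_le_two_pow`),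
`designRowD_upperBand` / `tropicalB_upperBand : n ≤ 2^{(20u+8)(K + ⌊log₂ m⌋²)}`.
[folklore] D. Gusfield (1980) for paths; the state count for bounded width is the standard extension.
-/

set_option linter.dupNamespace false
set_option autoImplicit false

namespace Summit.ValiantsHypothesis.ValiantsHypothesis.Theorems.KPlusLogSqLaw

open Summit.ValiantsHypothesis.ValiantsHypothesis.Theorems.MatrixDescartes.Negative
open Summit.ValiantsHypothesis.ValiantsHypothesis.Theorems.LacunarySymmetroidMatrixDescartes
open scoped BigOperators
open Finset

namespace IntervalOpt

variable {m K : ℕ} {d : Fin K → ℕ} {v ε : Fin m → Fin m → Fin K → ℤ}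

/-! ## 1. The recursion over (interval, image) pairs -/

/-- the image of the second half is the image of the whole minus the image of the first half. [folklore] -/
theorem image_eq_sdiff_of_union {J₁ J₂ : Finset (Fin m)} (hdisj : Disjoint J₁ J₂) (σ : Equiv.Perm (Fin m)) :
    J₂.image σ = (J₁ ∪ J₂).image σ \ J₁.image σ := by
  rw [Finset.image_union, Finset.union_sdiff_cancel_left ((Finset.disjoint_image σ.injective).2 hdisj)]

/-- two halves of a column interval are disjoint. [folklore] -/
theorem disjoint_ico_ico (a t c : ℕ) : Disjoint (ico m a t) (ico m t c) := by
  rw [Finset.disjoint_left]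
  intro i h1 h2
  rw [mem_ico] at h1 h2
  omega

/-- **STATE-COUNT META-THEOREM (Gusfield's recursion).**  Let `St a t` be finite families of row sets such that every PRESENT
term sends the column interval `[a, t)` onto a member of `St a t`, all of size `≤ T` (`T ≥ 1`).  Then a column interval of length
`≤ 2^k` has at most `(mK+1)·(2T)^k` optimal restrictions with any prescribed image `R`.  (The support class enters only through
`T`: counterexamples to the `K + log² m` law need super-polynomially many cut states.) [folklore] -/
theorem card_optRestr_img_le_of_states (St : ℕ → ℕ → Finset (Finset (Fin m))) (T : ℕ) (hT1 : 1 ≤ T)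
    (hT : ∀ a t : ℕ, (St a t).card ≤ T)
    (hSt : ∀ p : Equiv.Perm (Fin m) × (Fin m → Fin K), termSign ε p ≠ 0 → ∀ a t : ℕ, (ico m a t).image p.1 ∈ St a t) :
    ∀ (k a c : ℕ) (R : Finset (Fin m)), a ≤ c → c - a ≤ 2 ^ k →
      (optRestr d v ε (ico m a c) (fun p => (ico m a c).image p.1 = R)).card ≤ (m * K + 1) * (2 * T) ^ k := by
  classical
  intro k
  induction k with
  | zero =>
    intro a c R _ hl
    have hJ : (ico m a c).card ≤ 1 := (card_ico_le a c).trans (by simpa using hl)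
    calc _ ≤ m * K + 1 := card_optRestr_le_of_card_le_one hJ _
      _ = (m * K + 1) * (2 * T) ^ 0 := by simp
  | succ k ih =>
    intro a c R hac hl
    by_cases hsmall : c - a ≤ 2 ^ k
    · calc _ ≤ (m * K + 1) * (2 * T) ^ k := ih a c R hac hsmall
        _ ≤ (m * K + 1) * (2 * T) ^ (k + 1) :=
            Nat.mul_le_mul_left _ (Nat.pow_le_pow_right (by omega) (Nat.le_succ _))
    · -- split at `t = a + 2^k`
      set t := a + 2 ^ k with ht
      have hat : a ≤ t := by omega
      have htc : t ≤ c := by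
        have : 2 ^ (k + 1) = 2 ^ k + 2 ^ k := by rw [pow_succ]; ring
        omega
      have hl1 : t - a ≤ 2 ^ k := by omega
      have hl2 : c - t ≤ 2 ^ k := by
        have : 2 ^ (k + 1) = 2 ^ k + 2 ^ k := by rw [pow_succ]; ring
        omega
      have hsplit : ico m a c = ico m a t ∪ ico m t c := ico_union hat htc
      -- (i) cover by the state of the first half
      have hcover : optRestr d v ε (ico m a c) (fun p => (ico m a c).image p.1 = R) ⊆
          (St a t).biUnion fun S => optRestr d v ε (ico m a c)
            (fun p => (ico m a c).image p.1 = R ∧ (ico m a t).image p.1 = S) := by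
        intro r hr
        obtain ⟨p, θ, hq, hopt, rfl⟩ := mem_optRestr.1 hr
        exact Finset.mem_biUnion.2 ⟨(ico m a t).image p.1, hSt p hopt.1 a t,
          mem_optRestr.2 ⟨p, θ, ⟨hq, rfl⟩, hopt, rfl⟩⟩
      -- (ii) each group by sub-additivity and the induction hypothesis
      have hgroup : ∀ S ∈ St a t, (optRestr d v ε (ico m a c)
          (fun p => (ico m a c).image p.1 = R ∧ (ico m a t).image p.1 = S)).card ≤
            (m * K + 1) * (2 * T) ^ k + (m * K + 1) * (2 * T) ^ k := by
        intro S _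
        rw [hsplit]
        have step := card_optRestr_union_le (d := d) (v := v) (ε := ε) (J₁ := ico m a t) (J₂ := ico m t c)
          (Q := fun p => (ico m a t ∪ ico m t c).image p.1 = R ∧ (ico m a t).image p.1 = S)
          (Q₁ := fun p => (ico m a t).image p.1 = S)
          (Q₂ := fun p => (ico m t c).image p.1 = R \ S)
          (fun p h => h.2)
          (fun p h => by rw [image_eq_sdiff_of_union (disjoint_ico_ico a t c) p.1, h.1, h.2])
          (fun p p' h h' => by rw [h, h'])
          (fun p p' h h' => by rw [h, h'])
        exact step.trans (Nat.add_le_add (ih a t S hat hl1) (ih t c (R \ S) htc hl2))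
      -- (iii) sum over the states
      calc _ ≤ ((St a t).biUnion fun S => optRestr d v ε (ico m a c)
              (fun p => (ico m a c).image p.1 = R ∧ (ico m a t).image p.1 = S)).card := Finset.card_le_card hcover
        _ ≤ ∑ S ∈ St a t, (optRestr d v ε (ico m a c)
              (fun p => (ico m a c).image p.1 = R ∧ (ico m a t).image p.1 = S)).card := Finset.card_biUnion_le
        _ ≤ ∑ _S ∈ St a t, ((m * K + 1) * (2 * T) ^ k + (m * K + 1) * (2 * T) ^ k) :=
            Finset.sum_le_sum hgroup
        _ = (St a t).card * (2 * ((m * K + 1) * (2 * T) ^ k)) := by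
            rw [Finset.sum_const, smul_eq_mul]; ring
        _ ≤ T * (2 * ((m * K + 1) * (2 * T) ^ k)) := Nat.mul_le_mul_right _ (hT a t)
        _ = (m * K + 1) * (2 * T) ^ (k + 1) := by rw [pow_succ]; ring

/-- **chain form of the meta-theorem**: under the same state-count hypothesis, a dominant chain with distinct consecutive terms has
`n + 1 ≤ (mK+1)·(2T)^{⌊log₂ m⌋+1}` terms. [folklore] -/
theorem chain_le_of_states (St : ℕ → ℕ → Finset (Finset (Fin m))) (T : ℕ) (hT1 : 1 ≤ T)
    (hT : ∀ a t : ℕ, (St a t).card ≤ T)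
    (hSt : ∀ p : Equiv.Perm (Fin m) × (Fin m → Fin K), termSign ε p ≠ 0 → ∀ a t : ℕ, (ico m a t).image p.1 ∈ St a t)
    {n : ℕ} (θ : Fin (n + 1) → ℤ) (p : Fin (n + 1) → Equiv.Perm (Fin m) × (Fin m → Fin K)) (hθ : StrictMono θ)
    (hdom : ∀ k, IsDominant d v ε (θ k) (p k)) (hne : ∀ k : Fin n, p k.castSucc ≠ p k.succ) :
    n + 1 ≤ (m * K + 1) * (2 * T) ^ (Nat.log 2 m + 1) := by
  classical
  have hinj := injective_of_chainD d v ε θ p hθ hdom hne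
  have h1 := chain_le_card_optRestr (d := d) (v := v) (ε := ε) θ p hinj hdom
    (fun q => (ico m 0 m).image q.1 = ico m 0 m) (fun k => by rw [ico_univ]; exact Finset.image_univ_equiv _)
  rw [← (ico_univ : ico m 0 m = Finset.univ)] at h1
  have h2 := card_optRestr_img_le_of_states (d := d) (v := v) St T hT1 hT hSt (Nat.log 2 m + 1) 0 m (ico m 0 m)
    (Nat.zero_le _) (by have := Nat.lt_pow_succ_log_self one_lt_two m; omega)
  exact h1.trans h2

/-- **Gusfield's recursion with polynomially many states**, bounded up-jump case: for a design with up-jumps `≤ u` and a uniform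
bound `T` on the shape families, a column interval of length `≤ 2^k` has at most `(mK+1)·(2T)^k` optimal restrictions with any
prescribed image `R`. [folklore] -/
theorem card_optRestr_img_le {u : ℕ} (hU : ∀ (a b : Fin m) (l : Fin K), ε a b l ≠ 0 → (a : ℕ) ≤ (b : ℕ) + u) (T : ℕ)
    (hT : ∀ a t : ℕ, (shapes m u a t).card ≤ T) :
    ∀ (k a c : ℕ) (R : Finset (Fin m)), a ≤ c → c - a ≤ 2 ^ k →
      (optRestr d v ε (ico m a c) (fun p => (ico m a c).image p.1 = R)).card ≤ (m * K + 1) * (2 * T) ^ k :=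
  card_optRestr_img_le_of_states (shapes m u) T ((one_le_card_shapes (m := m) u 0 0).trans (hT 0 0)) hT
    fun _ hp a t => image_mem_shapes (row_le_add_of_present hU hp) a t

/-- **The unsigned chain bound on the bounded up-jump sector**: a dominant chain with distinct consecutive terms of a design with
up-jumps `≤ u` has `n + 1 ≤ (mK+1) · (2T)^{⌊log₂ m⌋ + 1}` terms, `T = ((2u+1)(m+1)^{2u})²`. [folklore] -/
theorem chain_le_upperBand {u : ℕ} (hU : ∀ (a b : Fin m) (l : Fin K), ε a b l ≠ 0 → (a : ℕ) ≤ (b : ℕ) + u) {n : ℕ}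
    (θ : Fin (n + 1) → ℤ) (p : Fin (n + 1) → Equiv.Perm (Fin m) × (Fin m → Fin K)) (hθ : StrictMono θ)
    (hdom : ∀ k, IsDominant d v ε (θ k) (p k)) (hne : ∀ k : Fin n, p k.castSucc ≠ p k.succ) :
    n + 1 ≤ (m * K + 1) * (2 * ((2 * u + 1) * (m + 1) ^ (2 * u)) ^ 2) ^ (Nat.log 2 m + 1) :=
  chain_le_of_states (shapes m u) _ ((one_le_card_shapes (m := m) u 0 0).trans (card_shapes_le u 0 0))
    (fun a t => card_shapes_le u a t) (fun _ hq a t => image_mem_shapes (row_le_add_of_present hU hq) a t) θ p hθ hdom hne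

/-! ## 2. Arithmetic and the sector theorem -/

/-- exponent bookkeeping: `(mK+1)·(2T)^{L+1} ≤ 2^{(20u+8)(K + L²)}` for `K ≥ 1`, `T = ((2u+1)(m+1)^{2u})²`, `L = ⌊log₂ m⌋`.
[folklore] -/
theorem upperBand_size_le_two_pow (m K u : ℕ) (hK : 1 ≤ K) :
    (m * K + 1) * (2 * ((2 * u + 1) * (m + 1) ^ (2 * u)) ^ 2) ^ (Nat.log 2 m + 1) ≤
      2 ^ ((20 * u + 8) * (K + Nat.log 2 m ^ 2)) := by
  set L := Nat.log 2 m with hL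
  have hm : m + 1 ≤ 2 ^ (L + 1) := Nat.lt_pow_succ_log_self one_lt_two m
  have hu : 2 * u + 1 ≤ 2 ^ (u + 1) := by
    have := Nat.lt_two_pow_self (n := u)
    rw [pow_succ]; omega
  have hKp : K < 2 ^ K := Nat.lt_two_pow_self
  -- `τ = (2u+1)(m+1)^{2u} ≤ 2^{u+1+2u(L+1)}`
  have hτ : (2 * u + 1) * (m + 1) ^ (2 * u) ≤ 2 ^ (u + 1 + 2 * u * (L + 1)) := by
    calc (2 * u + 1) * (m + 1) ^ (2 * u) ≤ 2 ^ (u + 1) * (2 ^ (L + 1)) ^ (2 * u) :=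
          Nat.mul_le_mul hu (Nat.pow_le_pow_left hm _)
      _ = 2 ^ (u + 1 + 2 * u * (L + 1)) := by rw [← pow_mul, ← pow_add]; ring_nf
  -- `2 τ² ≤ 2^{4uL + 6u + 3}`
  have h2τ : 2 * ((2 * u + 1) * (m + 1) ^ (2 * u)) ^ 2 ≤ 2 ^ (4 * u * L + 6 * u + 3) := by
    calc 2 * ((2 * u + 1) * (m + 1) ^ (2 * u)) ^ 2 ≤ 2 * (2 ^ (u + 1 + 2 * u * (L + 1))) ^ 2 :=
          Nat.mul_le_mul_left _ (Nat.pow_le_pow_left hτ 2)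
      _ = 2 ^ (4 * u * L + 6 * u + 3) := by rw [← pow_mul, ← pow_succ']; ring_nf
  -- the power
  have hpow : (2 * ((2 * u + 1) * (m + 1) ^ (2 * u)) ^ 2) ^ (L + 1) ≤ 2 ^ ((4 * u * L + 6 * u + 3) * (L + 1)) :=
    calc _ ≤ (2 ^ (4 * u * L + 6 * u + 3)) ^ (L + 1) := Nat.pow_le_pow_left h2τ _
      _ = 2 ^ ((4 * u * L + 6 * u + 3) * (L + 1)) := (pow_mul _ _ _).symm
  -- `mK + 1 ≤ 2^{L+1+K}`
  have hmK : m * K + 1 ≤ 2 ^ (L + 1 + K) := by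
    have h1 : m * K < 2 ^ (L + 1) * 2 ^ K := by
      calc m * K < (m + 1) * 2 ^ K := by nlinarith
        _ ≤ 2 ^ (L + 1) * 2 ^ K := Nat.mul_le_mul_right _ hm
    rw [← pow_add] at h1
    omega
  -- the exponent
  have hE : L + 1 + K + (4 * u * L + 6 * u + 3) * (L + 1) ≤ (20 * u + 8) * (K + L ^ 2) := by
    rcases Nat.eq_zero_or_pos L with h0 | hpos
    · rw [h0]; nlinarith
    · have e1 : 4 * u * L + 6 * u + 3 ≤ (10 * u + 3) * L := by nlinarith
      have e2 : (4 * u * L + 6 * u + 3) * (L + 1) ≤ (10 * u + 3) * L * (L + 1) := Nat.mul_le_mul_right _ e1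
      have e3 : (10 * u + 3) * L * (L + 1) ≤ (10 * u + 3) * L * (2 * L) := Nat.mul_le_mul_left _ (by omega)
      have e4 : (10 * u + 3) * L * (2 * L) = (20 * u + 6) * L ^ 2 := by ring
      have e5 : L + 1 ≤ 2 * L ^ 2 := by nlinarith
      nlinarith
  calc (m * K + 1) * (2 * ((2 * u + 1) * (m + 1) ^ (2 * u)) ^ 2) ^ (L + 1)
      ≤ 2 ^ (L + 1 + K) * 2 ^ ((4 * u * L + 6 * u + 3) * (L + 1)) := Nat.mul_le_mul hmK hpow
    _ = 2 ^ (L + 1 + K + (4 * u * L + 6 * u + 3) * (L + 1)) := (pow_add _ _ _).symm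
    _ ≤ 2 ^ ((20 * u + 8) * (K + L ^ 2)) := Nat.pow_le_pow_right (by norm_num) hE

/-- **`TropicalB` ON THE BOUNDED UP-JUMP SECTOR (unsigned row form).**  A design of format `(m, K)` whose present entries satisfy
`a ≤ b + u` has unsigned row bound `DesignRowD d v ε (2^{(20u+8)(K + ⌊log₂ m⌋²)})`. [folklore: Gusfield 1980] -/
theorem designRowD_upperBand (u : ℕ) (d : Fin K → ℕ) (v ε : Fin m → Fin m → Fin K → ℤ)
    (hU : ∀ (a b : Fin m) (l : Fin K), ε a b l ≠ 0 → (a : ℕ) ≤ (b : ℕ) + u) :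
    DesignRowD d v ε (2 ^ ((20 * u + 8) * (K + Nat.log 2 m ^ 2))) := by
  rcases Nat.eq_zero_or_pos K with hK | hK
  · subst hK
    exact designRowD_of_tropRowD (tropRowD_zero _ _) d v ε
  · intro n θ p hθ hdom hne
    have h1 := chain_le_upperBand hU θ p hθ hdom hne
    have h2 := upperBand_size_le_two_pow m K u hK
    omega

/-- the Hessenberg predicate is the case `u = 1`. [folklore] -/
theorem upJump_one_of_isHessenberg (hH : IsHessenberg ε) :
    ∀ (a b : Fin m) (l : Fin K), ε a b l ≠ 0 → (a : ℕ) ≤ (b : ℕ) + 1 := hH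

end IntervalOpt

open IntervalOpt in
/-- **`TropicalB` ON THE BOUNDED UP-JUMP SECTOR.**  For every `u` there is `C` (`= 20u + 8`) such that for ALL `m, K`, every
tropical design of format `(m, K)` whose entry in row `a`, column `b` is present only if `a ≤ b + u` admits at most
`2^{C (K + ⌊log₂ m⌋²)}` sign alternations along any strictly increasing integer parameter sequence of dominant terms — the statement
of the crux `TropicalB` with the one extra support hypothesis, in the window `log₂ m + 1 < K < m` included; `u = 1` is the
Hessenberg sector (`tropicalB_hessenberg`).  Gusfield's divide and conquer with `≤ ((2u+1)(m+1)^{2u})²` cut states.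
[folklore: Gusfield 1980] -/
theorem tropicalB_upperBand (u : ℕ) : ∃ C : ℕ, ∀ (m K : ℕ) (d : Fin K → ℕ) (v ε : Fin m → Fin m → Fin K → ℤ) (n : ℕ)
    (θ : Fin (n + 1) → ℤ) (p : Fin (n + 1) → Equiv.Perm (Fin m) × (Fin m → Fin K)),
    (∀ (a b : Fin m) (l : Fin K), ε a b l ≠ 0 → (a : ℕ) ≤ (b : ℕ) + u) → (∀ i j l, (ε i j l).natAbs ≤ 1) → StrictMono θ →
    (∀ k, IsDominant d v ε (θ k) (p k)) → (∀ k : Fin n, termSign ε (p k.castSucc) * termSign ε (p k.succ) < 0) →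
    n ≤ 2 ^ (C * (K + Nat.log 2 m ^ 2)) :=
  ⟨20 * u + 8, fun _ _ d v ε _ θ p hU _ hθ hdom halt =>
    designRowD_upperBand u d v ε hU _ θ p hθ hdom (ne_succ_of_alternating ε p halt)⟩

end Summit.ValiantsHypothesis.ValiantsHypothesis.Theorems.KPlusLogSqLaw
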